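import Literature.NumberTheory.Automorphic.ModularLambdaCovering
import Literature.NumberTheory.Automorphic.ModularLambdaSurjective
import Literature.Topology.CoveringSpaces.CoveringPreimageComponent
import Mathlib.Analysis.Complex.UpperHalfPlane.Topology
import HarnessLib

/-!
# Fisher–Hubbard–Wittner, Lemma 3.1: a plane domain omitting `0, 1` is covered by a domain in `ℍ` via `λ`

Topic `Literature/Analysis/Complex`.  Y. Fisher, J. H. Hubbard, B. S. Wittner, *A proof of the
uniformization theorem for arbitrary plane domains*, PAMS 104 (1988), Lemma 3.1 p. 414 («Reduction to
bounded domains»): «Let `p : D → ℂ − {a, b}` be a universal covering map; there is such a `p` by Theorem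
2.1 [the modular function] […] Let `U₀` be a connected component of `p⁻¹(U)`; then `U₀` is contained in
`D`, and since `U₀` is a covering space of `U` they have isomorphic universal covering spaces.»
(Zakeri 2021, Thm 13.15 Step 1: «the universal covering `λ : 𝔻 → ℂ ∖ {0,1}` […] if `V_λ ⊂ 𝔻` is the
connected component of `λ⁻¹(U)` containing `0`, then `λ|_{V_λ} : (V_λ, 0) → (U, q)` is a covering map».)

With the tree's modular function `λ : ℍ → ℂ ∖ {0, 1}` (`isCoveringMap_modularLambda`,
`ModularLambdaCovering.lean`) in place of `p : D → ℂ − {a, b}` (the disc and `ℍ` being conformally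
isomorphic), and the generic «path components of `p⁻¹(V)` cover `V`» (`CoveringPreimageComponent.lean`):

* **`exists_upperHalfPlane_domain_covering`** — for every open connected `U ⊆ ℂ ∖ {0, 1}` there is an
  open connected `W ⊆ {Im > 0}`, on which `λ` is holomorphic, with `λ(W) = U` and
  `λ|_W : W → U` a COVERING MAP; based: through any prescribed `τ₀ ∈ ℍ` with `λ τ₀ ∈ U`.

Everything is a theorem; no definition.  Nothing here bears on [IUTchIII] Cor. 3.12.

## References

* Y. Fisher, J. H. Hubbard, B. S. Wittner, PAMS 104 (1988) 413–418, Lemma 3.1 (p. 414).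
  [FisherHubbardWittner1988]
-/

noncomputable section

open Topology Set Function Filter
open scoped UpperHalfPlane

namespace Literature.Analysis.Complex

open Literature.NumberTheory.Automorphic Literature.NumberTheory.Automorphic.ModularLambda
open Literature.Topology.CoveringSpaces

/-- **FHW Lemma 3.1 (via `λ`)**: let `U ⊆ ℂ ∖ {0, 1}` be open and connected and `τ₀ ∈ ℍ` with
`λ τ₀ ∈ U`.  Then there is an open connected `W ⊆ {z | 0 < Im z}` containing `τ₀`, on which `λ` is
holomorphic, with `λ(W) = U` and `λ|_W : W → U` a covering map — `W` is (the image in `ℂ` of) the path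
component of `τ₀` in `λ⁻¹(U)`. [cite: FisherHubbardWittner1988, Lemma 3.1 (p. 414)] -/
theorem exists_upperHalfPlane_domain_covering {U : Set ℂ} (hU : IsOpen U) (hUc : IsPreconnected U)
    (hU01 : U ⊆ ({0, 1}ᶜ : Set ℂ)) (τ₀ : ℍ) (hτ₀ : modularLambda (τ₀ : ℂ) ∈ U) :
    ∃ (W : Set ℂ) (hW : MapsTo modularLambda W U), IsOpen W ∧ IsConnected W ∧ (τ₀ : ℂ) ∈ W ∧
      W ⊆ {z : ℂ | 0 < z.im} ∧ DifferentiableOn ℂ modularLambda W ∧ modularLambda '' W = U ∧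
      IsCoveringMap (hW.restrict modularLambda W U) := by
  -- the covering `p = λ : ℍ → ℂ ∖ {0,1}` and the open preconnected `V := U` read in `ℂ ∖ {0,1}`
  have h01 : IsOpen (({0, 1}ᶜ : Set ℂ)) := (Set.toFinite ({0, 1} : Set ℂ)).isClosed.isOpen_compl
  haveI : LocallyPathConnectedSpace ↥(({0, 1}ᶜ : Set ℂ)) :=
    h01.isOpenEmbedding_subtypeVal.locallyPathConnectedSpace
  set p : ℍ → ↥(({0, 1}ᶜ : Set ℂ)) := fun z => ⟨modularLambda (z : ℂ), fun h =>
    h.elim (modularLambda_ne_zero z.2) (modularLambda_ne_one z.2)⟩ with hp_def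
  have hp : IsCoveringMap p := isCoveringMap_modularLambda
  set V : Set ↥(({0, 1}ᶜ : Set ℂ)) := Subtype.val ⁻¹' U with hV_def
  have hVo : IsOpen V := hU.preimage continuous_subtype_val
  have hVc : IsPreconnected V :=
    hUc.preimage_of_isOpenMap Subtype.val_injective (h01.isOpenEmbedding_subtypeVal.isOpenMap)
      (by rw [Subtype.range_coe]; exact hU01)
  let e₀ : p ⁻¹' V := ⟨τ₀, show (p τ₀ : ℂ) ∈ U from hτ₀⟩
  obtain ⟨hcov, hsurj⟩ := hp.restrictPreimage_pathComponent hVo hVc e₀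
  -- `W` = image in `ℂ` of the path component `C` of `e₀` in `p⁻¹(V)`
  set ι : ↥(p ⁻¹' V) → ℂ := fun c => ((c : ℍ) : ℂ) with hι_def
  have hι : IsOpenEmbedding ι :=
    UpperHalfPlane.isOpenEmbedding_coe.comp (hVo.preimage hp.continuous).isOpenEmbedding_subtypeVal
  set C : Set ↥(p ⁻¹' V) := pathComponent e₀ with hC_def
  haveI : LocallyPathConnectedSpace ↥(p ⁻¹' V) :=
    (hVo.preimage hp.continuous).isOpenEmbedding_subtypeVal.locallyPathConnectedSpace
  have hCo : IsOpen C := IsOpen.pathComponent e₀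
  refine ⟨ι '' C, ?_, hι.isOpenMap _ hCo, ?_, ⟨e₀, mem_pathComponent_self e₀, rfl⟩, ?_, ?_, ?_, ?_⟩
  · -- `λ(W) ⊆ U`
    rintro _ ⟨c, -, rfl⟩
    exact c.2
  · -- connected
    exact (isPathConnected_pathComponent.image hι.continuous).isConnected
  · -- inside the upper half plane
    rintro _ ⟨c, -, rfl⟩
    exact (c : ℍ).2
  · -- holomorphic
    exact differentiableOn_modularLambda.mono (by rintro _ ⟨c, -, rfl⟩; exact (c : ℍ).2)
  · -- `λ(W) = U`
    refine Subset.antisymm (by rintro _ ⟨_, ⟨c, -, rfl⟩, rfl⟩; exact c.2) fun u hu => ?_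
    obtain ⟨⟨c, hc⟩, hcu⟩ := hsurj ⟨⟨u, hU01 hu⟩, hu⟩
    refine ⟨ι c, ⟨c, hc, rfl⟩, ?_⟩
    have := congrArg (fun y : ↥V => ((y : ↥(({0, 1}ᶜ : Set ℂ))) : ℂ)) hcu
    exact this
  · -- covering: transport `C → V` along `C ≃ₜ W` and `V ≃ₜ U`
    have hιC : IsEmbedding (fun c : ↥C => ι c) := hι.isEmbedding.comp IsEmbedding.subtypeVal
    have hrange : range (fun c : ↥C => ι c) = ι '' C := by
      ext z
      simp only [mem_range, mem_image]
      constructor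
      · rintro ⟨c, rfl⟩; exact ⟨c.1, c.2, rfl⟩
      · rintro ⟨c, hc, rfl⟩; exact ⟨⟨c, hc⟩, rfl⟩
    let eC : ↥C ≃ₜ ↥(ι '' C) := hιC.toHomeomorph.trans (Homeomorph.setCongr hrange)
    have hvalV : IsEmbedding (fun y : ↥V => ((y : ↥(({0, 1}ᶜ : Set ℂ))) : ℂ)) :=
      IsEmbedding.subtypeVal.comp IsEmbedding.subtypeVal
    have hrangeV : range (fun y : ↥V => ((y : ↥(({0, 1}ᶜ : Set ℂ))) : ℂ)) = U := by
      ext u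
      constructor
      · rintro ⟨y, rfl⟩; exact y.2
      · intro hu; exact ⟨⟨⟨u, hU01 hu⟩, hu⟩, rfl⟩
    let eV : ↥V ≃ₜ ↥U := hvalV.toHomeomorph.trans (Homeomorph.setCongr hrangeV)
    have key := (hcov.comp_homeomorph eC.symm).homeomorph_comp eV
    convert key using 1
    funext w
    apply Subtype.ext
    -- both sides are `λ` of the underlying point of `ℍ`
    obtain ⟨w, hw⟩ := w
    show modularLambda w = ((eV (C.restrict (V.restrictPreimage p) (eC.symm ⟨w, hw⟩))) : ℂ)
    have h1 : (eV (C.restrict (V.restrictPreimage p) (eC.symm ⟨w, hw⟩)) : ℂ) =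
        modularLambda (((eC.symm ⟨w, hw⟩ : ↥C) : ↥(p ⁻¹' V)) : ℍ) := rfl
    rw [h1]
    congr 1
    have h2 : ι ((eC.symm ⟨w, hw⟩ : ↥C) : ↥(p ⁻¹' V)) = w := by
      have := congrArg Subtype.val (eC.apply_symm_apply ⟨w, hw⟩)
      exact this
    exact h2.symm

end Literature.Analysis.Complex
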